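import Literature.Computability.Complexity.ACFourierTails
import HarnessLib

/-!
# Crux `MobiusLadder.LiouvilleOrthogonalTC0` (stmt-QuantumAdvantage-1393): one switching round for an
arbitrary `±1`-valued function with a free restriction parameter

Line `Sketch`, skeleton v11 (lead `prover-line-stmt-QuantumAdvantage-1393-c6-0`), registered stub
`stub_switchRound` (the THR-of-AC⁰ rung). This is Tal's switching round (Tal 2017, Lemma 3.1 in
Chebyshev form + Lemma 3.3 along Håstad's canonical common `ℓ'`-partial decision tree of a family of
DNFs `Fam`), for a GENERAL function `g` with `g² = 1`, a FREE restriction parameter `p ∈ [0,1]`, and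
the bad event left as its raw `R_p`-mass:

`W^{≥k}[g] ≤ 2 (ε + Pr_{ρ∼R_p}[ccDepth_{ℓ'}(Fam|ρ) ≥ D+1])`

whenever `p k ≥ 8`, `2D ≤ p k / 2`, and `W^{≥D}[g|τ] ≤ ε` at every restriction `τ` under which all
`Fam i` have canonical decision trees of depth `≤ ℓ'`.

Proof (a near-verbatim generalisation of the tree's `ACForm.tailWeight_round_le`, file
`Literature/Computability/Complexity/ACFourierTails.lean`, with `sgnEval f` replaced by `g` and the
multi-switching estimate of the bad event omitted): by Chebyshev (`half_le_sum_subsetWeight_free`,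
threshold `j = 2D`) and Lemma 3.1 (`tailWeight_le_two_mul_sum_rrWeight`),
`W^{≥k}[g] ≤ 2 𝔼_ρ W^{≥2D}[g|ρ]`; on the bad restrictions `W^{≥2D}[g|ρ] ≤ 1` (`tailWeight_le_one`), on
the good ones (`ccDepth ≤ D`) Lemma 3.3 (`tailWeight_add_procDepth_le` with the leaves of the common
tree, `cdt_le_of_mem_procLeaves`) gives `W^{≥2D}[g|ρ] ≤ W^{≥D+ccDepth}[g|ρ] ≤ ε`, and the good masses
sum to `≤ 1` (`sum_rrWeight`).

* `stub_switchRound` — the registered stub, verbatim.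
-/

set_option linter.dupNamespace false -- D-0017: single-problem summit ⇒ `QuantumAdvantage.QuantumAdvantage` by design

noncomputable section

namespace Summit.QuantumAdvantage.QuantumAdvantage.Theorems.LiouvilleOrthogonalTC0

open Finset
open Literature.Computability.Complexity
open Literature.Computability.Complexity.LowDegree (tailWeight tailWeight_le_one tailWeight_nonneg
  tailWeight_antitone tailWeight_le_two_mul_sum_rrWeight half_le_sum_subsetWeight_free
  tailWeight_add_procDepth_le)

/-- **One switching round for an arbitrary `±1`-valued function** (Tal 2017, Lemma 3.1 in Chebyshev
form + Lemma 3.3 + the canonical common `ℓ'`-partial decision tree of a family of DNFs, with a FREE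
restriction parameter `p` and the bad event left as its raw `R_p`-mass): if at every restriction `τ`
where all `Fam i|τ` have canonical decision trees of depth `≤ ℓ'` one has `W^{≥D}[g|τ] ≤ ε`, then
`W^{≥k}[g] ≤ 2(ε + Pr_{ρ∼R_p}[ccDepth_{ℓ'}(Fam|ρ) ≥ D+1])`, provided `pk ≥ 8` and `2D ≤ pk/2`. -/
theorem stub_switchRound {n : ℕ} (g : (Fin n → Bool) → ℝ) (hg : ∀ x, g x ^ 2 = 1)
    {m' ℓ' : ℕ} (Fam : Fin m' → CNF (Fin n)) (hFv : ∀ i, ∀ C ∈ Fam i, VarNodup C)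
    {p : ℝ} (hp0 : 0 ≤ p) (hp1 : p ≤ 1) {k D : ℕ} (h8 : (8 : ℝ) ≤ p * k)
    (h2D : ((2 * D : ℕ) : ℝ) ≤ p * k / 2) {ε : ℝ} (hε : 0 ≤ ε)
    (hleaf : ∀ τ : PAssign n, (∀ i, cdt (Fam i) τ ≤ ℓ') →
      tailWeight (fun x => g (τ.apply x)) D ≤ ε) :
    tailWeight g k ≤ 2 * (ε + ∑ ρ ∈ Finset.univ.filter
      (fun ρ : PAssign n => D + 1 ≤ ccDepth ℓ' Fam n ρ), rrWeight p ρ) := by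
  -- Lemma 3.1 (threshold `2D`), the probability hypothesis by Chebyshev
  have h31 := tailWeight_le_two_mul_sum_rrWeight g hp0 hp1 (j := 2 * D) (k := k) fun S hS => by
    have hkS : (k : ℝ) ≤ S.card := by exact_mod_cast hS
    refine half_le_sum_subsetWeight_free hp0 hp1 S ?_ ?_
    · nlinarith
    · calc ((2 * D : ℕ) : ℝ) ≤ p * k / 2 := h2D
        _ ≤ p * S.card / 2 := by gcongr
  refine h31.trans (mul_le_mul_of_nonneg_left ?_ zero_le_two)
  -- split the expectation into bad and good restrictions
  have hsplit := Finset.sum_filter_add_sum_filter_not univ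
    (fun ρ : PAssign n => D + 1 ≤ ccDepth ℓ' Fam n ρ)
    (fun ρ => rrWeight p ρ * tailWeight (fun x => g (ρ.apply x)) (2 * D))
  rw [← hsplit]
  -- bad part: `W^{≥2D}[g|ρ] ≤ 1`
  have hbad : ∑ ρ ∈ univ.filter (fun ρ : PAssign n => D + 1 ≤ ccDepth ℓ' Fam n ρ),
      rrWeight p ρ * tailWeight (fun x => g (ρ.apply x)) (2 * D) ≤
      ∑ ρ ∈ univ.filter (fun ρ : PAssign n => D + 1 ≤ ccDepth ℓ' Fam n ρ), rrWeight p ρ :=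
    Finset.sum_le_sum fun ρ _ => mul_le_of_le_one_right (rrWeight_nonneg hp0 hp1 ρ)
      (tailWeight_le_one (fun x => hg _) _)
  -- good part: Lemma 3.3 along the common tree, `2D ≥ D + ccDepth`
  have hgood : ∑ ρ ∈ univ.filter (fun ρ : PAssign n => ¬ D + 1 ≤ ccDepth ℓ' Fam n ρ),
      rrWeight p ρ * tailWeight (fun x => g (ρ.apply x)) (2 * D) ≤ ε := by
    have hpt : ∀ ρ ∈ univ.filter (fun ρ : PAssign n => ¬ D + 1 ≤ ccDepth ℓ' Fam n ρ),
        rrWeight p ρ * tailWeight (fun x => g (ρ.apply x)) (2 * D) ≤ rrWeight p ρ * ε := by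
      intro ρ hρ
      simp only [Finset.mem_filter, Finset.mem_univ, true_and, not_le] at hρ
      refine mul_le_mul_of_nonneg_left ?_ (rrWeight_nonneg hp0 hp1 ρ)
      have hproc := tailWeight_add_procDepth_le (swQuery_subset_free ℓ' Fam hFv) g D n ρ
        (ε := ε) fun τ hτ => hleaf τ fun i => cdt_le_of_mem_procLeaves ℓ' Fam hFv ρ hτ i
      refine le_trans (tailWeight_antitone _ ?_) hproc
      have : ccDepth ℓ' Fam n ρ = procDepth (swQuery ℓ' Fam) n ρ := rfl
      omega
    refine (Finset.sum_le_sum hpt).trans ?_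
    rw [← Finset.sum_mul]
    calc (∑ ρ ∈ univ.filter (fun ρ : PAssign n => ¬ D + 1 ≤ ccDepth ℓ' Fam n ρ), rrWeight p ρ) * ε
        ≤ (∑ ρ : PAssign n, rrWeight p ρ) * ε :=
          mul_le_mul_of_nonneg_right (Finset.sum_le_sum_of_subset_of_nonneg (Finset.subset_univ _)
            fun ρ _ _ => rrWeight_nonneg hp0 hp1 ρ) hε
      _ = ε := by rw [sum_rrWeight, one_mul]
  linarith

end Summit.QuantumAdvantage.QuantumAdvantage.Theorems.LiouvilleOrthogonalTC0
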